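import Literature.MathematicalPhysics.QuantumFieldTheory.PointwiseOSReconstruction
import Literature.Probability.LatticeModels.HighDimTrivialityWick
import Literature.Probability.LatticeModels.CriticalScalingDimension
import Literature.Barriers.CriticalPhenomena.ScaleCovarianceNotMoebius
import Summits.CriticalPhenomena.Ising3DConformalLimit.Theses.HyperoctahedralRP

/-!
# Crux `InversionUpgradeNormalised` (stmt-CriticalPhenomena-1982) — ideator 2 sketch (round 1)

First lemmas of the two idea cards `Ideas/light-cone-hsm-special-conformal.md` (C1) and
`Ideas/free-endpoint-gaussian-closure.md` (C2), typed over existing declarations, plus the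
proved reduction of the crux to its interior stratum `1/2 < Δ ∧ HasNontrivialU4 S` (C2).
-/

noncomputable section

namespace Summit.CriticalPhenomena.Ising3DConformalLimit.Cruxes.InversionUpgradeNormalised.Ideator2

open Literature.Probability.LatticeModels Literature.MathematicalPhysics.QuantumFieldTheory
open EuclideanGeometry

/-! ## C1 — the Osterwalder–Schrader inputs of the modular line -/

/-- **C1, first lemma.** Every normalised, Euclidean-invariant, scale-covariant pointwise scaling
limit of the critical correlators on `ℤ³` satisfies the premises of the pointwise OS reconstruction
along EACH coordinate axis `τ` (reflection positivity of `criticalCorr 3` in the three coordinate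
site-mirrors — FILS 1978 / tree `isingMeasure_univ_free_reflectionPositive` — is a closed condition
and passes to the limit on non-coincident half-space configurations; reflection invariance is a
lattice symmetry; permutation symmetry holds for moments; polynomial time growth from
`0 ≤ S_{2n} ≤ 𝒢_n[S₂]` (Griffiths I / Newman's Gaussian bound) and `S₂ = C‖x-y‖^{-2Δ}`). With the given
`IsRotationInvariant S` this is OS positivity in every plane: the Hilbert space, vacuum, `e^{-tH}`,
spatial translations — and, through the rotations mixing the time axis, the Lorentz boosts of the
reconstructed 2+1-dimensional dilation-covariant Wightman theory on which the modular line runs. -/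
def CriticalLimitOSAllAxes : Prop :=
  ∀ (ρ : ℝ → ℝ) (Δ : ℝ) (S : CorrFamily 3), (∀ δ ∈ Set.Ioc (0:ℝ) 1, 0 < ρ δ) →
    HasPointwiseScalingLimit (criticalCorr 3) ρ S → (∀ n z, z ∉ NonCoincident 3 n → S n z = 0) →
    IsNondegenerateTwoPoint S → IsEuclideanInvariant S → IsScaleCovariant Δ S →
    ∀ τ : Fin 3, PointwiseOSReconstruction τ S

/-- The unit inversion preserves every open coordinate half-space `{x_τ > 0}` (its centre lies on
the mirror), so it acts on half-space configurations. [folklore] -/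
def invertConfig {τ : Fin 3} (a : HalfSpaceConfig 3 τ) : HalfSpaceConfig 3 τ where
  n := a.n
  pts := fun i => inversion 0 1 (a.pts i)
  injective := by
    intro i j h
    have h0 : ∀ k, a.pts k ≠ 0 := fun k hk => by have := a.pos k; simp [hk] at this
    exact a.injective (inversion_injective (0 : EuclideanSpace ℝ (Fin 3)) one_ne_zero h)
  pos := fun i => by
    have hp := a.pos i
    have h0 : a.pts i ≠ 0 := fun hk => by simp [hk] at hp
    simp only [inversion, dist_zero_right, vsub_eq_sub, sub_zero, vadd_eq_add, add_zero,
      PiLp.smul_apply, smul_eq_mul]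
    exact mul_pos (by positivity) hp

/-- The Kelvin weight `w_Δ(a) = ∏ᵢ ‖aᵢ‖^{-2Δ}` of a configuration. [folklore] -/
def invWeight (Δ : ℝ) {τ : Fin 3} (a : HalfSpaceConfig 3 τ) : ℝ := ∏ i, ‖a.pts i‖ ^ (-(2 * Δ))

/-- **C1, target-side dictionary** (provable now, pure algebra): if `S` is inversion covariant with
weight `Δ` and `θ_τ`-invariant, the weighted geometric inversion `δ_a ↦ w_Δ(a) δ_{ιa}` preserves the
OS form along `τ` — i.e. `ι` is implemented by an ISOMETRY `U_ι` of the OS pre-Hilbert space (a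
unitary involution of `h.Hilbert` commuting with the transfer semigroup conjugated to the special
conformal semigroup, `U_ι e^{-tH} U_ι = e^{-tK}`). The modular line reads the crux as the existence of
this unitary and manufactures it from the Araki–Zsidó flow of the diamond-in-light-cone inclusion. -/
def InversionActsIsometrically : Prop :=
  ∀ (Δ : ℝ) (S : CorrFamily 3) (τ : Fin 3), IsInversionCovariant Δ S →
    IsReflectionInvariantAlong τ S →
    ∀ (k : ℕ) (a : Fin k → HalfSpaceConfig 3 τ) (c : Fin k → ℝ),
      ∑ i, ∑ j, c i * c j * (invWeight Δ (a i) * invWeight Δ (a j) *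
        osPointKernel S (invertConfig (a i)) (invertConfig (a j))) =
      ∑ i, ∑ j, c i * c j * osPointKernel S (a i) (a j)

/-! ## C2 — the free endpoint and the Gaussian locus are already inversion covariant -/

/-- **C2, first lemma** (provable now): a normalised, Euclidean-invariant, scale-covariant family on
`ℝ³` with vanishing odd correlators whose even correlators obey Wick's rule off the diagonals is
inversion covariant with the same weight — the generalised free field of dimension `Δ` is Möbius
covariant (`‖ιx - ιy‖ = ‖x - y‖/(‖x‖‖y‖)`, Mathlib `dist_inversion_inversion`, termwise on pairings;
`S₂(x,y) = S₂(0,e)‖x-y‖^{-2Δ}` from Euclidean invariance + scale covariance). -/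
def GaussianFamilyInversionCovariant : Prop :=
  ∀ (Δ : ℝ) (S : CorrFamily 3), 0 < Δ → (∀ n z, z ∉ NonCoincident 3 n → S n z = 0) →
    IsEuclideanInvariant S → IsScaleCovariant Δ S →
    (∀ n (x : Fin n → EuclideanSpace ℝ (Fin 3)), Odd n → S n x = 0) →
    (∀ n, 2 ≤ n → ∀ x ∈ NonCoincident 3 (2 * n),
      S (2 * n) x = pairingSum (fun p q => S 2 ![p, q]) n x) →
    IsInversionCovariant Δ S

/-- **C2, the free endpoint** (Jost–Schroer–Pohlmeyer in lattice clothes; named-fact level): at the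
free-field value `Δ = 1/2` (the lower end of the rigorous window `scalingDimension_mem_Icc`) a
normalised, non-degenerate, Euclidean-invariant, scale-covariant limit of the critical correlators has
`U₄ ≡ 0` off the diagonals — by OS reconstruction (C1 first lemma) the spin field is a Wightman scalar
with the two-point function of the free massless field, hence free (Pohlmeyer, CMP 12 (1969) 204),
hence Wick; with `CriticalWickDichotomy` this is the whole Gaussian structure. -/
def FreeEndpointWick : Prop :=
  ∀ (ρ : ℝ → ℝ) (S : CorrFamily 3), (∀ δ ∈ Set.Ioc (0:ℝ) 1, 0 < ρ δ) →
    HasPointwiseScalingLimit (criticalCorr 3) ρ S → (∀ n z, z ∉ NonCoincident 3 n → S n z = 0) →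
    IsNondegenerateTwoPoint S → IsEuclideanInvariant S → IsScaleCovariant (1/2) S →
    ∀ z ∈ NonCoincident 3 4, limitConnectedFour S z = 0

/-- **C2, the interior crux**: `InversionUpgradeNormalised` restricted to the open stratum
`1/2 < Δ` (i.e. `η = 2Δ - 1 > 0`) and `U₄ ≢ 0` — the two facts every other line may now use for free. -/
def InteriorInversionUpgrade : Prop :=
  ∀ (ρ : ℝ → ℝ) (Δ : ℝ) (S : CorrFamily 3), (∀ δ ∈ Set.Ioc (0:ℝ) 1, 0 < ρ δ) →
    HasPointwiseScalingLimit (criticalCorr 3) ρ S → (∀ n z, z ∉ NonCoincident 3 n → S n z = 0) →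
    IsNondegenerateTwoPoint S → IsEuclideanInvariant S → IsScaleCovariant Δ S →
    1/2 < Δ → HasNontrivialU4 S → IsInversionCovariant Δ S


/-- Tree theorem `HasPointwiseScalingLimit.eq_zero_of_odd` (CriticalWickDichotomy, PROVED; restated as a
shape only because that module is not yet built on the farm): odd orders of every pointwise limit of
`criticalCorr 3` vanish on non-coincident configurations (`m*(β_c) = 0`). -/
def OddOrdersVanishShape : Prop :=
  ∀ (ρ : ℝ → ℝ) (S : CorrFamily 3), HasPointwiseScalingLimit (criticalCorr 3) ρ S →
    ∀ n, Odd n → ∀ x ∈ NonCoincident 3 n, S n x = 0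

/-- Tree theorem `HasPointwiseScalingLimit.eq_pairingSum_of_limitConnectedFour_eq_zero`
(CriticalWickDichotomy, PROVED — Aizenman 1982 Prop. 12.1 / Newman 1975 passed to pointwise limits;
restated as a shape for the same reason): `U₄ ≡ 0` off the diagonals ⇒ Wick at every even order. -/
def WickDichotomyShape : Prop :=
  ∀ (ρ : ℝ → ℝ) (S : CorrFamily 3), HasPointwiseScalingLimit (criticalCorr 3) ρ S →
    (∀ z ∈ NonCoincident 3 4, limitConnectedFour S z = 0) →
    ∀ n, 2 ≤ n → ∀ x ∈ NonCoincident 3 (2 * n), S (2 * n) x = pairingSum (fun p q => S 2 ![p, q]) n x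

/-- **C2, reduction (proved).** The crux follows from its interior stratum, the Gaussian-locus lemma
and the free-endpoint fact: `Δ ∈ [1/2,1]` (`scalingDimension_mem_Icc_holds`); at `Δ = 1/2` the limit
is Wick (`FreeEndpointWick` + `CriticalWickDichotomy`), on `Δ > 1/2` either `HasNontrivialU4 S`
(interior) or `U₄ ≡ 0` off the diagonals and the limit is Wick again
(`HasPointwiseScalingLimit.eq_pairingSum_of_limitConnectedFour_eq_zero`, `eq_zero_of_odd`);
Wick families are inversion covariant (`GaussianFamilyInversionCovariant`). -/
theorem inversionUpgrade_of_strata (hodd0 : OddOrdersVanishShape) (hW : WickDichotomyShape)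
    (hG : GaussianFamilyInversionCovariant) (hF : FreeEndpointWick) (hI : InteriorInversionUpgrade) :
    Summit.CriticalPhenomena.Ising3DConformalLimit.Theses.HyperoctahedralRP.InversionUpgradeNormalised := by
  intro ρ Δ S hρ hlim hnorm hnd heuc hsc
  have hΔ : Δ ∈ Set.Icc (1 / 2 : ℝ) 1 := scalingDimension_mem_Icc_holds ρ Δ S hlim hsc hnd hρ
  -- odd orders vanish everywhere (`m*(β_c) = 0` on non-coincident configurations, normalisation off)
  have hodd : ∀ n (x : Fin n → EuclideanSpace ℝ (Fin 3)), Odd n → S n x = 0 := by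
    intro n x hn
    by_cases hx : x ∈ NonCoincident 3 n
    · exact hodd0 ρ S hlim n hn x hx
    · exact hnorm n x hx
  -- Wick at every even order from `U₄ ≡ 0` off the diagonals
  have hwick : (∀ z ∈ NonCoincident 3 4, limitConnectedFour S z = 0) →
      ∀ n, 2 ≤ n → ∀ x ∈ NonCoincident 3 (2 * n),
        S (2 * n) x = pairingSum (fun p q => S 2 ![p, q]) n x :=
    fun hU n hn x hx => hW ρ S hlim hU n hn x hx
  have hΔpos : 0 < Δ := lt_of_lt_of_le one_half_pos hΔ.1
  rcases eq_or_lt_of_le hΔ.1 with h | h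
  · -- the free endpoint Δ = 1/2
    have hsc' : IsScaleCovariant (1 / 2) S := h ▸ hsc
    have hU := hF ρ S hρ hlim hnorm hnd heuc hsc'
    exact hG Δ S hΔpos hnorm heuc hsc hodd (hwick hU)
  · by_cases hU4 : HasNontrivialU4 S
    · exact hI ρ Δ S hρ hlim hnorm hnd heuc hsc h hU4
    · have hU : ∀ z ∈ NonCoincident 3 4, limitConnectedFour S z = 0 := by
        intro z hz
        by_contra hne
        exact hU4 ⟨z, hz, hne⟩
      exact hG Δ S hΔpos hnorm heuc hsc hodd (hwick hU)


/-! ## C2 — proof of the Gaussian-locus lemma -/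

section GaussianProof

open Literature.Barriers.CriticalPhenomena Finset

/-- Two-point structure of a Euclidean-invariant, scale-covariant family: for `a ≠ b`,
`S₂(a,b) = ‖a - b‖^{-2Δ} · S₂(0,e₁)` (translate `a` to `0`, reflect `b - a` onto `‖b - a‖ e₁`
with `Submodule.reflection_sub`, scale by `‖b - a‖`). [folklore] -/
theorem two_point_eq {Δ : ℝ} {S : CorrFamily 3} (heuc : IsEuclideanInvariant S)
    (hsc : IsScaleCovariant Δ S) {a b : EuclideanSpace ℝ (Fin 3)} (hab : a ≠ b) :
    S 2 ![a, b] = ‖a - b‖ ^ (-(2 * Δ)) * S 2 ![0, EuclideanSpace.single 0 1] := by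
  set e : EuclideanSpace ℝ (Fin 3) := EuclideanSpace.single 0 1 with he
  have hne : ‖e‖ = 1 := by simp [he]
  set r : ℝ := ‖b - a‖ with hr
  have hr0 : 0 < r := norm_pos_iff.mpr (sub_ne_zero.mpr (Ne.symm hab))
  -- translate by `-a`
  have h1 : S 2 ![a, b] = S 2 ![0, b - a] := by
    have h := heuc.1 2 (-a) ![a, b]
    rw [← h]
    congr 1
    funext i
    fin_cases i <;> simp [sub_eq_add_neg]
  -- reflect `b - a` onto `r • e`
  have hnorm_eq : ‖b - a‖ = ‖r • e‖ := by
    rw [norm_smul, hne, mul_one, Real.norm_eq_abs, abs_of_pos hr0]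
  have hRv : Submodule.reflection (ℝ ∙ ((b - a) - r • e))ᗮ (b - a) = r • e :=
    Submodule.reflection_sub hnorm_eq
  have h2 : S 2 ![0, b - a] = S 2 ![0, r • e] := by
    have h := heuc.2 2 (Submodule.reflection (ℝ ∙ ((b - a) - r • e))ᗮ) ![0, b - a]
    rw [← h]
    congr 1
    funext i
    fin_cases i <;> simp [hRv]
  -- scale by `r`
  have h3 : S 2 ![0, r • e] = r ^ (-(2 * Δ)) * S 2 ![0, e] := by
    have h := hsc 2 r hr0 ![0, e]
    have hfun : (fun i => r • (![0, e] : Fin 2 → EuclideanSpace ℝ (Fin 3)) i) = ![0, r • e] := by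
      funext i
      fin_cases i <;> simp
    have hexp : (-((2 : ℕ) : ℝ) * Δ) = -(2 * Δ) := by push_cast; ring
    rw [hfun, hexp] at h
    exact h
  rw [h1, h2, h3, hr, norm_sub_rev]

/-- The two-point inversion law on the Gaussian locus: `S₂(ιp, ιq) = ‖p‖^{2Δ}‖q‖^{2Δ} S₂(p, q)`
for distinct non-zero `p, q` (`ScaleNotMoebius.twoPt_inversion`). [folklore] -/
theorem two_point_inversion {Δ : ℝ} {S : CorrFamily 3} (heuc : IsEuclideanInvariant S)
    (hsc : IsScaleCovariant Δ S) {p q : EuclideanSpace ℝ (Fin 3)} (hpq : p ≠ q) (hp : p ≠ 0)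
    (hq : q ≠ 0) :
    S 2 ![inversion 0 1 p, inversion 0 1 q] = ‖p‖ ^ (2 * Δ) * ‖q‖ ^ (2 * Δ) * S 2 ![p, q] := by
  have hinj := inversion_injective (0 : EuclideanSpace ℝ (Fin 3)) one_ne_zero
  have hpq' : inversion 0 1 p ≠ inversion 0 1 q := fun h => hpq (hinj h)
  rw [two_point_eq heuc hsc hpq', two_point_eq heuc hsc hpq]
  have key := ScaleNotMoebius.twoPt_inversion Δ hp hq
  simp only [ScaleNotMoebius.twoPt] at key
  rw [key]
  ring

/-- Reindexing the Kelvin weights of a pairing: for a permutation `τ` of `Fin (2m)`,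
`∏_j w(x_{τ(2j)}) w(x_{τ(2j+1)}) = ∏_i w(x_i)`. [folklore] -/
theorem prod_pair_weights {α : Type*} (w : α → ℝ) (m : ℕ) (x : Fin (2 * m) → α)
    (τ : Equiv.Perm (Fin (2 * m))) :
    ∏ j : Fin m, (w (x (τ (pairIdx m (j, 0)))) * w (x (τ (pairIdx m (j, 1))))) =
      ∏ i, w (x i) := by
  calc ∏ j : Fin m, (w (x (τ (pairIdx m (j, 0)))) * w (x (τ (pairIdx m (j, 1)))))
      = ∏ j : Fin m, ∏ k : Fin 2, w (x (τ (pairIdx m (j, k)))) := by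
        refine Finset.prod_congr rfl fun j _ => ?_
        rw [Fin.prod_univ_two]
    _ = ∏ p : Fin m × Fin 2, w (x (τ (pairIdx m p))) := by
        rw [← Finset.univ_product_univ, Finset.prod_product]
    _ = ∏ i : Fin (2 * m), w (x (τ i)) :=
        Fintype.prod_equiv (pairIdx m) _ _ fun p => rfl
    _ = ∏ i, w (x i) := Equiv.prod_comp τ (fun i => w (x i))

/-- **C2, first lemma — PROVED.** Wick families (normalised, Euclidean invariant, scale covariant,
odd orders zero) are inversion covariant with the same weight. -/
theorem gaussianFamilyInversionCovariant_holds : GaussianFamilyInversionCovariant := by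
  intro Δ S hΔ hnorm heuc hsc hodd hwick n x hx0
  set ι : EuclideanSpace ℝ (Fin 3) → EuclideanSpace ℝ (Fin 3) := inversion 0 1 with hι
  have hinj : Function.Injective ι := inversion_injective (0 : EuclideanSpace ℝ (Fin 3)) one_ne_zero
  obtain ⟨k, rfl | rfl⟩ := Nat.even_or_odd' n
  · -- even order `n = 2k`
    by_cases hx : Function.Injective x
    · have hιx : Function.Injective (fun i => ι (x i)) := hinj.comp hx
      rcases k with _ | _ | k
      · -- `n = 0`: both configurations are the empty one
        have hi : ∀ i : Fin (2 * 0), False := fun i => by have := i.isLt; omega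
        have hfun : (fun i => ι (x i)) = x := funext fun i => (hi i).elim
        rw [hfun, Finset.prod_eq_one (fun i _ => (hi i).elim), one_mul]
      · -- `n = 2`
        have hx01 : x 0 ≠ x 1 := fun h => absurd (hx h) (by decide)
        have hxv : x = ![x 0, x 1] := by funext i; fin_cases i <;> rfl
        have hιv : (fun i => ι (x i)) = ![ι (x 0), ι (x 1)] := by funext i; fin_cases i <;> rfl
        rw [hιv, hxv]
        simp only [Matrix.cons_val_zero, Matrix.cons_val_one]
        rw [Fin.prod_univ_two]
        simp only [Matrix.cons_val_zero, Matrix.cons_val_one]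
        exact two_point_inversion heuc hsc hx01 (hx0 0) (hx0 1)
      · -- `n = 2(k+2) ≥ 4`: Wick on both sides, termwise inversion law
        have hk : 2 ≤ k + 2 := by omega
        rw [hwick (k + 2) hk _ hιx, hwick (k + 2) hk _ hx]
        unfold pairingSum
        rw [Finset.mul_sum, Finset.mul_sum, Finset.mul_sum]
        refine Finset.sum_congr rfl fun τ _ => ?_
        have hterm : ∀ j : Fin (k + 2),
            S 2 ![ι (x (τ (pairIdx (k + 2) (j, 0)))), ι (x (τ (pairIdx (k + 2) (j, 1))))] =
              (‖x (τ (pairIdx (k + 2) (j, 0)))‖ ^ (2 * Δ) * ‖x (τ (pairIdx (k + 2) (j, 1)))‖ ^ (2 * Δ)) *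
                S 2 ![x (τ (pairIdx (k + 2) (j, 0))), x (τ (pairIdx (k + 2) (j, 1)))] := by
          intro j
          have hne : x (τ (pairIdx (k + 2) (j, 0))) ≠ x (τ (pairIdx (k + 2) (j, 1))) := by
            intro h
            have h1 := τ.injective (hx h)
            have h2 := (pairIdx (k + 2)).injective h1
            simp at h2
          rw [two_point_inversion heuc hsc hne (hx0 _) (hx0 _)]
        simp_rw [hterm]
        rw [Finset.prod_mul_distrib, prod_pair_weights (fun p => ‖p‖ ^ (2 * Δ)) (k + 2) x τ]
        ring
    · -- non-injective: both sides vanish by the normalisation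
      have hιx : ¬ Function.Injective (fun i => ι (x i)) := fun h => hx (hinj.of_comp_iff x |>.mp h)
      rw [hnorm _ _ hιx, hnorm _ _ hx, mul_zero]
  · -- odd order: both sides vanish
    rw [hodd _ _ ⟨k, rfl⟩, hodd _ _ ⟨k, rfl⟩, mul_zero]

/-- **C2, reduction with the Gaussian-locus lemma discharged**: the crux follows from the two tree
theorems of `CriticalWickDichotomy` (shapes `OddOrdersVanishShape`, `WickDichotomyShape`), the
free-endpoint fact (Pohlmeyer) and the interior crux. -/
theorem inversionUpgrade_of_interior (hodd0 : OddOrdersVanishShape) (hW : WickDichotomyShape)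
    (hF : FreeEndpointWick) (hI : InteriorInversionUpgrade) :
    Summit.CriticalPhenomena.Ising3DConformalLimit.Theses.HyperoctahedralRP.InversionUpgradeNormalised :=
  inversionUpgrade_of_strata hodd0 hW gaussianFamilyInversionCovariant_holds hF hI

end GaussianProof

end Summit.CriticalPhenomena.Ising3DConformalLimit.Cruxes.InversionUpgradeNormalised.Ideator2

end
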